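import Summits.BirchSwinnertonDyer.Rank1Residual.Additive.RamifiedSevenResidualNonvanishingOfGenus
import Literature.NumberTheory.EllipticCurves.Kato2004.IwasawaCohomologyNumberFieldRestriction
import Literature.NumberTheory.EllipticCurves.Kato2004.IwasawaH1Reduction
import Literature.NumberTheory.EllipticCurves.ZpExtensionRestrictCyclotomic
import Literature.AlgebraicGeometry.Motives.FaltingsEC
import HarnessLib

set_option autoImplicit false

/-!
# `𝒞₇` genus road (crux `EllipticUnitValueSevenOfGZK`, K7r), row (K2C-1) block (P1): the PINNED Kato-side frame
# `PinnedKatoGenusFrame` — (B1b)'s `KatoGenusFrame` EXTENDED by VALUE/MECHANISM PINS of its abstract carriers: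
# (λ3) `𝐇′(S′_W)` IS the tree's `K`-side Iwasawa cohomology `IK.H` of `T₇W` over the CM field, `j` IS the Shapiro
# restriction `resOver`, `π` acts as the CM endomorphism `√−7`; (λ1) `EU_𝔟` IS the Prop. 15.9 class of the elliptic
# units (tree predicate `CM.EllipticZetaBody`); (N2) the genus frame is the member's own — a HYPOTHESIS STRUCTURE
# (nothing asserted to exist), the monotonicity to (B1b), and the pinned closed-form LETTER of crux K2ᶜ as a binder

Cell bsd-cm, seat bsd-cm-prr-ty1 g29 (literature-prover), SUMMON `wake/SUMMON-bsd-cm-prr-ty1-20260830T1331Z.md`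
(5310ddf656b65669; planner D889/D890), caveat (κ′) of D887 and (κ) of (B1b)'s module docstring, idea-20 g63 (c2)/(N1)/(N2)
(HOME INBOX l.299), reading note `Cruxes/EllipticUnitValueSevenOfGZK/K2cCollapse-g57.md` (C1)–(C4), frozen proof-memo
`MEMO-bsd-cm-genus` v1 (a38f3eedd2c92d58) §3 (F1)–(F4), §4 (L3)–(L4), §5, §9.  HONEST LABEL: this file DEFINES a hypothesis
structure and proves its elementary API and two projections; it asserts NOTHING to exist, mints NO named fact, registers no
stub (the closed form is carried as a hypothesis TYPE only, the pen's to register); stmt-BirchSwinnertonDyer-19945 is OPEN;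
`X12.CMRamifiedSeven` is NOT proved; no summit statement is proved by this seat; BSD is claimed for no curve.

## The defect cured (caveat (κ′), D887; idea-20 (c2)) and the pins, in tree currency (memo §3–§5, §9; F7 dictionary)

In (B1b)'s `KatoGenusFrame` the carriers `R`, `A`, `frame.HS` and the data `j`, `zS`, `u`, `a`, `t`, `frame.zeta`, `frame.EU`
carry NO value pins, so the registered K2ᶜ stub has the CHEAP INHABITANT `A = R = Λ_O`, `HS = ⊤`, `j =` base change of the
free rank-one `I.H`, `zS = zeta = EU 𝔟 =` the index series of `zOne` (`u = t = C = 1`, `a = 0`), whose only non-trivial field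
`EU_not_mem_of_residue` reads «residue `≠ 0` → `z₀ ∉ 7·I.H`»: modulo {K1ᵘ, Tsuji, FW, ★, GZK} the stub is the road's implication,
not Kato's comparison.  THIS FILE adds FIELDS (nothing asserted) under which `Φ` can only be Kato's own objects, up to the leaks
listed below.
* **(λ3) `𝐇′(S′_W)` IS the `K`-side Iwasawa cohomology, `j` IS restriction, `π` IS the CM endomorphism.**  For a member `W` (CM
  by an order of `K = ℚ(√−7)`) the split hull `S′_W ⊃ T_W^O = T₇W ⊗_{ℤ₇} O_𝔭` (index `7 = |O_𝔭×O_𝔭 : O_𝔭 ⊗_{ℤ₇} O_𝔭|`, memo (L3))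
  is `T₇W ⊕ T₇W^ι ≅ T₇W ⊗ ℤ₇[Gal(K/ℚ)] = Ind_{G_K}^{G_ℚ}(T₇W|_{G_K})`, so by Shapiro/15.14 `𝐇′(S′_W) = H¹_Iw(Kℚ_∞/K, T₇W)` = the
  tree's PINNED `IK : IwasawaH1DataOver (W.baseChange Kcm) 7 (K.restrictOfFinrankEqTwo _ Kcm _) γK` (jointly bijective `proj`: rigid), and the
  coefficient extension `j` (adjunction unit `t ↦ (t, t)`) is the tree's `IwasawaH1Data.resOver I IK hγ hγK` (memo (P0)(i), F7
  l.90–105).  FIELDS: `ιS : IK.H →ₗ[Λ] A` injective with range `frame.HS` (`ιS_injective`, `mem_HS_iff`), `j = ιS ∘ resOver`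
  (`j_eq`), an endomorphism `φ` of `W_K` with `φ ∘ φ = [−7]` and `π • ιS y = ιS y′ ⇒` the layers of `y′` are `(T₇φ)_*` of those of
  `y` (`proj_pi`; tree `mapH1AddHom` ∘ `TateModule.map`, equivariant by `tateModule_map_smul`).  So `ιS` is rigid up to
  `Aut_{Λ_O}` of the rank-one `𝐇′(S′_W)` = `Λ_O^×`: the `GL₂(Λ)`-freedom of an unpinned `Λ`-identification is gone.
* **(λ2) `zS`, `zW`, `frame.zeta` need no new field**: they are `K_𝔭`-multiples of `res(𝐳_{γ_W}) = 7^{−k}·j(zOne)` (memo §5,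
  (L3)), `zOne` is VALUE-PINNED by the inherited ★-field `zOne_pos` and `j_zOne` in the `π`-torsion-free `A`; what stays free is
  Kato's lattice datum `a ∈ {0,1}` (the member's position; CONTENT, bounded by the inherited `a_le_one`) and units.
* **(λ1) `frame.EU 𝔟` IS the Prop. 15.9 class of the `𝔟`-elliptic units.**  Kato's map (15.12.1)∘15.14 (Kummer(`_𝔟z_{7^m𝔣}`) ∪ `e`,
  cores `K(7^m𝔣) → Kℚ_n`; memo (F3), §9) is NOT a typed map of the tree (STATUS CHECK (15.9) 13:41:56Z), so the field is the
  PROP-LEVEL characterisation the tree has: `frame.EU 𝔟 = ιS (euK 𝔟)`, `IK.proj n (euK 𝔟) = w (Gal(K̄/Kℚ_n))` for a witness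
  `(w, y)` of `CM.EllipticZetaBody Kcm (W.baseChange Kcm) 7 ψ (7·|D|) ι Ω 𝔏 𝔟 w y` ((Z1) norm-compatible over EVERY ray-class
  layer of the two-variable tower `K(7^∞𝔣)/K`, (Z2) integral, (Z3) datum axioms, (Z4) rationality, (Z5) Kato's value law
  (15.9.1)), ONE `(ψ, ι, Ω, 𝔏)` for all twists, `ψ` pinned as THE Grössencharacter of `W` exactly as in
  `CM.prop159_ellipticUnits_expStar_values` (type `(1,0)`, `heckeLFunction ψ = W.LSeries` on `re s > 3/2`, `cond ψ ∣ (7D)`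
  transcribed), the cyclotomic layers recorded as ray-class layers (`isRayClassLayer_layer`).  Conductor datum: `𝔣 = 𝔭·(D)`
  (inherited) and Kato's `(f) = (7·|D|) ⊆ 𝔣`; the elliptic units of the moduli `7^n(7D)` and `7^{n+1}𝔣` interleave into one
  norm-coherent family (§15.5), and the VALUE pin sees layers, not moduli.
* **(N2)** the genus frame is the member's own: the bad primes `≠ 7` of `W` are the prime divisors of `D` (`bad_iff_dvd`; memo
  (N2)) — modularity-free form of idea-20's `∃ f : CuspForm (Gamma0 (49·d²)) 2, IsNewformOf W f`.

## What the pinned `∃Φ`-form says; the (κ-check); the honest leaks (numbers, not adjectives)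

An inhabitant must: produce the `K`-side carrier with its CM `Λ_O`-structure, identify `HS`/`j` with `IK.H`/`res` (rigid up to
`Λ_O^×`), exhibit the Prop. 15.9 classes over the WHOLE ray-class tower with Kato's values (named fact `CM.prop159_…` for
maximal-order members, else a construction), place `zeta` against ★ through `res` (datum `a`), AND prove (i) the FRAME-LEMMA pin
`EU_not_mem_of_residue` for THAT `EU` (memo (F3)–(F4), (G7′)(1)–(2)) and (ii) the shape `EU_𝔟 ∈ Λ_O·𝐳_{γ′}` = Kato's
(15.16.1)∘15.14 read INTEGRALLY (Kato: after `⊗ℚ` by values + separation — Prop. 15.9, Thm. 12.5 (1) via ★, LEMMA S of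
`K2cCollapse-g57.md`; integrality = 15.14's «similarly» = THE research kernel).  (κ-check), TWO cheap inhabitants, both
excluded (planner D893/D894, idea-20 (S1)): (a) the VALUE-FREE one of D887 (`EU := zeta = zS =` an index series) is excluded
by (λ1) alone — a cyclotomic-only class cannot supply the two-variable witness `w` ((Z1) between `K(7^n𝔣)` and `Kℚ_m`:
cores ∘ res = degree; the zero family violates (Z5) wherever `L_{7f}(ψ̄,χ,1) ≠ 0`); (b) the RESCALED one (`ιS := s • φ` carrying
`EU` against an UNSCALED `j := φ ∘ resOver`, idea-20 (S1)) is NOT excluded by (λ1) alone; it IS excluded by (λ1) + (λ3) AS A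
FACTORISATION `j = ιS ∘ resOver` (field `j_eq`: ONE structure map `ιS` carries both `euK 𝔟` and `res zOne`, so any change of
`ιS` moves `EU 𝔟`, `j zOne`, `zS`, `zeta` together and the comparison constant is invariant; degenerate `ιS` is blocked by
`EU_not_mem_of_residue` and by `j_zOne` + `π`-torsion-freeness).  LEAKS: (ℓ1′) the abstract datum `𝔏` of the tree's Prop. 15.9
body absorbs `(w, 𝔏) ↦ (λ·w, 𝔏 ∘ λ⁻¹)` for `λ ∈ Λ_O` invertible on every rational layer with `λ·w` integral (idea-20 (W2)); the
`π`-adic part of `λ` is self-limited inside the frame (upward refuted by `EU_not_mem_of_residue` when the genus residue `≠ 0`,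
downward = `7^m`-divisibility of the genuine family at every ray-class layer = the negation of K2ᶜ's content), so `K2cPinned`
pins the `π`-ADIC content of (15.16.1)∘15.14 leak-free (all RNV7 consumes) and NOT the prime-to-`π` integrality of Kato's
constant — immaterial for the road; cure of the whole leak = a DEFINED `exp*_K` or the Kummer ∪ `e` ∘ cores map (neither in
the tree); (ℓ2) `φ = ±√−7`, `ιS` up to `Λ_O^×` — units; (ℓ3) `a` is the inhabitant's subject to `zeta_eq`/`j_zOne` (= Kato's
`a_W` once `zeta` is genuine); (ℓ4) the genus frame's existence `(F, θu)` stays folded into the closed form ((F∃); STATUS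
CHECK (F4∃)); (ℓ5) `ψ_LSeries` pins `ψ` up to `ψ ∘ c`, `bad_iff_dvd` pins `|D|` up to the `7`-isogenous twist `D ↔ −7D` —
immaterial (`∃ F`, and (B3)/(B4) are `∀ Φ`).  Net: modulo {K1ᵘ, Tsuji, FW, ★, GZK, Prop. 15.9}
the pinned stub is «(15.16.1)∘15.14 integrally at the split hull for the Prop-15.9-pinned classes ∧ the frame lemma for them».

## Contents and references
§0 helpers (continuity of `T₇φ`, `endLayerMap`; the `K`-tower is the tree's `ZpExtension.restrictOfFinrankEqTwo`); §1 `PinnedKatoGenusFrame … extends KatoGenusFrame …`; §2 API (`ιS` as an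
equivalence onto `HS`, the CM operator `piK` with `ιS (piK y) = π • ιS y` and its layers, `j = ιS ∘ res`, the body of `EU`);
§3 `residueIsGenusUnitClass_of_pinned` (one line) and the CLOSED-FORM LETTER «K2cPinned» := `★ → GZK → ∀ W …, ∃ (F, θu) pinned,
∀ d, ∃ Φ : PinnedKatoGenusFrame W K hK I d, ResidueIsGenusUnitClassShape Φ.toKatoGenusFrame` as the hypothesis binder of
`hK2c_of_k2cPinned` (⇒ (B3)'s `hK2c` letter VERBATIM) and `residualNonvanishingSeven_of_k2cPinned` (⇒ RNV7).  K. Kato,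
Astérisque 295 (2004) Prop. 15.9/(15.9.1) (pp. 258–259), (15.11.2)–(15.11.3) (pp. 260–262), (15.12.1) (p. 262), 15.14 (p. 264),
(15.16.1)/Prop. 15.17 (p. 265), Thm. 12.4 (2)/12.5 (1) (p. 221) [Kato2004Asterisque]; Neukirch–Schmidt–Wingberg (2008) I §5–§6
[NeukirchSchmidtWingberg2008]; Serre, *Galois Cohomology* I §2 [SerreGaloisCohomology1997]; memo §3–§5, §9; `K2cCollapse-g57.md`;
(B1b)/(B3)/(B4) p774033/p774409/p774837.
-/

noncomputable section

open scoped NumberField TensorProduct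
open Field IsDedekindDomain NumberField
open Literature.NumberTheory.GaloisRepresentations
open Literature.NumberTheory.EllipticCurves
open Literature.NumberTheory.EllipticCurves.Rank1Residual
open Literature.NumberTheory.EllipticCurves.IwasawaAlgebra
open Literature.NumberTheory.EllipticCurves.Kato2004
open Literature.NumberTheory.ComplexMultiplication.EllipticUnits
open Summit.BirchSwinnertonDyer.Rank1Residual

namespace Summit.BirchSwinnertonDyer.Rank1Residual.Additive.GenusSeven

/-! ## §0 Helpers: continuity of `T₇φ` and its push-forward on a layer (the cyclotomic `ℤ₇`-extension of the CM
field is the tree's `ZpExtension.restrictOfFinrankEqTwo (by decide) Kcm _` = `K.restrict Kcm _`, Kato's 15.14 tower) -/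

section Continuity

variable {L : Type} [Field L] {V V' : WeierstrassCurve L} (p : ℕ) [Fact p.Prime]

/-- `T_p f : T_pV → T_pV'` is continuous for the profinite topologies (coordinatewise a map between discrete sets); the
tree's `continuous_tateModule_map` verbatim over an arbitrary base field. [cite: SilvermanAEC2009, III.7.4] -/
theorem continuous_tateModule_map_of_field (f : V.geomPoints →+ V'.geomPoints) :
    Continuous (TateModule.map p f) := by
  refine continuous_induced_rng.2 (continuous_pi fun n => ?_)
  change Continuous fun x : V.tateModule p => TateModule.proj p n (TateModule.map p f x)
  simp only [TateModule.proj_map]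
  exact continuous_of_discreteTopology.comp (TateModule.continuous_proj n)

end Continuity

section LayerMap

variable {L : Type} [Field L] (V : WeierstrassCurve L) [ContinuousSMul ℤ_[7] (V.tateModule 7)]

/-- **`(T₇φ)_* : H¹(U, T₇V) → H¹(U, T₇V)`** for an endomorphism `φ` of the elliptic curve `V/L` defined over `L`
(an `L`-isogeny `V → V`) and any `U ≤ Γ_L`: functoriality of continuous `H¹(U, –)` along the continuous
`Γ_L`-equivariant `ℤ₇`-linear map `T₇φ` (tree `mapH1AddHom`, `TateModule.map`, `tateModule_map_smul`).  For `φ = √−7`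
on a CM member this is the action of `π ∈ O_𝔭 = End ⊗ ℤ₇` on the layer `H¹(Kℚ_n, T₇W)` of `𝐇′(S′_W)` (15.14: `O_λ`
acts on `H^q(T)` through the lattice). [cite: SerreGaloisCohomology1997, I §2.2] [cite: Kato2004Asterisque, 15.14 (p. 264)] -/
def endLayerMap (φ : WeierstrassCurve.Isogeny V V) (U : Subgroup (absoluteGaloisGroup L)) :
    H1 (CM.tateRepK V 7) U →+ H1 (CM.tateRepK V 7) U :=
  mapH1AddHom (subgroupRep (CM.tateRepK V 7).toTopRep U) (subgroupRep (CM.tateRepK V 7).toTopRep U)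
    (TateModule.map 7 φ.toAddMonoidHom).toAddMonoidHom (continuous_tateModule_map_of_field 7 φ.toAddMonoidHom)
    (fun g x => Literature.AlgebraicGeometry.Motives.tateModule_map_smul 7 φ (g : absoluteGaloisGroup L) x)

end LayerMap

/-! ## §1 The pinned frame -/

/-- **The PINNED Kato-side frame of a member `W`** over a cyclotomic datum `(K, hK, γ, I)` and a genus datum `d` (module
docstring «The pins»): (B1b)'s `KatoGenusFrame W K hK I d` EXTENDED by — (λ3) the `K`-side pinned Iwasawa cohomology
`IK` of `T₇W|_{G_K}` along `Kℚ_∞/K` with a topological generator `γK`, a `Λ`-linear injection `ιS : IK.H → A` with range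
`frame.HS` (`𝐇′(S′_W) = H¹_Iw(Kℚ_∞/K, T₇W)`, Shapiro/15.14), `j = ιS ∘ resOver` (the coefficient extension is restriction),
an `L`-endomorphism `φ` of `W_K` with `φ ∘ φ = [−7]` whose `T₇`-functoriality on the layers is the action of `π`
(`proj_pi`); (λ1) `frame.EU 𝔟 = ιS (euK 𝔟)` with `euK 𝔟` the class whose layer components are the Prop. 15.9 classes of
the `𝔟`-elliptic units (tree `CM.EllipticZetaBody` with ONE Grössencharacter/embedding/period/datum `(ψ, ι, Ω, 𝔏)` pinned
as in `CM.prop159_ellipticUnits_expStar_values`, conductor datum `f = 7·|D|`); (N2) `bad_iff_dvd`.  HYPOTHESIS STRUCTURE;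
nothing is asserted to exist; no instance beyond the structure-field idiom of (B1b).
[cite: Kato2004Asterisque, Prop. 15.9 (15.9.1) (pp. 258–259), (15.11.2)–(15.11.3) (pp. 260–262), (15.12.1) (p. 262), 15.14 (p. 264), (15.16.1) (p. 265)]
[cite: NeukirchSchmidtWingberg2008, I §6 (Shapiro's lemma) and I §5 (res)] -/
structure PinnedKatoGenusFrame (W : WeierstrassCurve ℚ) [W.IsElliptic] [W.IsGloballyMinimal] [Fact (Nat.Prime 7)]
    [ContinuousSMul ℤ_[7] (W.tateModule 7)] (K : ZpExtension ℚ 7) (hK : K.IsCyclotomic)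
    {γ : Field.absoluteGaloisGroup ℚ} (I : IwasawaH1Data W 7 K γ)
    {F : GenusFrame} {θu : ∀ n : ℕ, globalUnitsOf (F.layer n)} (d : GenusDatum F θu)
    extends KatoGenusFrame W K hK I d where
  /-- (N2) the genus frame is the member's own: the bad primes of `W` other than `7` are the prime divisors of `D`. -/
  bad_iff_dvd : ∀ (q : ℕ) [Fact q.Prime], q ≠ 7 → (¬ Good W q ↔ q ∣ F.d)
  /-- (λ3) a topological generator `γK` of the cyclotomic `ℤ₇`-extension `Kℚ_∞/K` of the CM field (`K.restrict Kcm _`). -/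
  γK : absoluteGaloisGroup Kcm
  isTopGenerator_γK : (K.restrictOfFinrankEqTwo (by decide) Kcm finrank_Kcm).IsTopGenerator γK
  /-- The `ℤ₇`-module structure of `T₇(W_K)` is jointly continuous (structure fact; supply `TateModule.continuousSMul_padicInt`). -/
  [instContK : ContinuousSMul ℤ_[7] ((W.baseChange Kcm).tateModule 7)]
  /-- (λ3) the `K`-side pinned Iwasawa cohomology `H¹_Iw(Kℚ_∞/K, T₇W) = lim← H¹(O_{Kℚ_n}[1/7], T₇W)` (= `𝐇′(S′_W)` by Shapiro). -/
  IK : IwasawaH1DataOver (W.baseChange Kcm) 7 (K.restrictOfFinrankEqTwo (by decide) Kcm finrank_Kcm) γK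
  /-- (λ3) `𝐇′(S′_W) ↪ 𝐇′(𝒱′)`: a `Λ`-linear injection of `IK.H` into `A` … -/
  ιS : IK.H →ₗ[IwasawaAlgebra 7] A
  ιS_injective : Function.Injective ιS
  /-- … whose range is exactly `frame.HS = 𝐇′(S′_W)`. -/
  mem_HS_iff : ∀ x : A, x ∈ frame.HS ↔ ∃ y : IK.H, ιS y = x
  /-- (λ3) the coefficient extension `j : I.H → 𝐇′(S′_W)` IS the Shapiro restriction `res : 𝐇¹_Γ(T₇W) → 𝐇¹_{K,Γ}(T₇W_K)`. -/
  j_eq : ∀ hγ : K.IsTopGenerator γ, j = ιS ∘ₗ I.resOver IK hγ isTopGenerator_γK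
  /-- (λ3) the CM endomorphism `φ = √−7` of `W_K` (defined over `K`): `φ ∘ φ = [−7]` on `W(K̄)`. -/
  φ : WeierstrassCurve.Isogeny (W.baseChange Kcm) (W.baseChange Kcm)
  φ_sq : ∀ P : (W.baseChange Kcm).geomPoints, φ (φ P) = (-7 : ℤ) • P
  /-- (λ3) `π ∈ R = Λ_O` acts on `HS = ιS(IK.H)` as `√−7`: if `ιS y′ = π • ιS y` then every layer class of `y′` is
  `(T₇φ)_*` of that of `y`. -/
  proj_pi : ∀ (n : ℕ) (y y' : IK.H), ιS y' = π • ιS y →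
    IK.proj n y' = endLayerMap (W.baseChange Kcm) φ ((K.restrictOfFinrankEqTwo (by decide) Kcm finrank_Kcm).layerSubgroup n) (IK.proj n y)
  /-- (λ1) THE Grössencharacter of `W` over `K` (type `(1,0)` = Kato's `(−1,0)`, `L(ψ, s) = L(W, s)`), a complex embedding of
  `K̄` extending the infinite place, ONE period and ONE dual-exponential value datum, and the `K`-side elliptic-unit classes. -/
  ψ : HeckeCharacter Kcm
  ψ_infinityType : ψ.HasInfinityType (fun _ ↦ 1) (fun _ ↦ 0)
  ψ_LSeries : ∀ s : ℂ, 3 / 2 < s.re → heckeLFunction ψ s = W.LSeries s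
  ιC : AlgebraicClosure Kcm →+* ℂ
  ιC_infinitePlace : ∀ (w : InfinitePlace Kcm) (x : Kcm), ιC (algebraMap Kcm (AlgebraicClosure Kcm) x) = w.embedding x
  /-- `cond ψ ∣ (7·|D|)` transcribed as in `CM.prop159_…`: `ψ((α)) = ι(α)` for `α ≡ 1 mod 7|D|`, `α ≠ 0`. -/
  ψ_conductor : ∀ α : 𝓞 Kcm, α ≠ 0 → ((7 * F.d : ℕ) : 𝓞 Kcm) ∣ α - 1 →
    CM.heckeCharIdealValue ψ (Ideal.span {α}) = ιC (algebraMap Kcm (AlgebraicClosure Kcm) (α : Kcm))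
  Ω : ℂ
  Ω_ne_zero : Ω ≠ 0
  𝔏 : ∀ U : Subgroup (absoluteGaloisGroup Kcm),
    H1 (CM.tateRepK (W.baseChange Kcm) 7) U →ₗ[ℤ_[7]] ℚ_[7] ⊗[ℤ] AlgebraicClosure Kcm
  /-- The cyclotomic layers `Kℚ_n` are layers of the ray-class tower `K(7^∞·(7D))/K` (`Kℚ_n ⊂ K(ζ_{7^{n+1}}) ⊂ K(W[7^{n+1}])`). -/
  isRayClassLayer_layer : ∀ n : ℕ,
    CM.IsRayClassLayer (W.baseChange Kcm) 7 (7 * F.d) ((K.restrictOfFinrankEqTwo (by decide) Kcm finrank_Kcm).layerSubgroup n)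
  /-- (λ1) the `K`-side class `euK 𝔟 ∈ 𝐇¹_{K,Γ}(T₇W_K)` of the `𝔟`-elliptic units … -/
  euK : Ideal (𝓞 Kcm) → IK.H
  /-- … whose layer components are Prop. 15.9 classes `w_{𝔟,Kℚ_n}` carrying Kato's values (15.9.1), for every admissible twist `𝔟` … -/
  euK_spec : ∀ 𝔟 : Ideal (𝓞 Kcm), IsTwist 7 𝔣 𝔟 →
    ∃ (w : ∀ U : Subgroup (absoluteGaloisGroup Kcm), H1 (CM.tateRepK (W.baseChange Kcm) 7) U)
      (y : Subgroup (absoluteGaloisGroup Kcm) → AlgebraicClosure Kcm),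
      CM.EllipticZetaBody Kcm (W.baseChange Kcm) 7 ψ (7 * F.d) ιC Ω 𝔏 𝔟 w y ∧
      ∀ n : ℕ, IK.proj n (euK 𝔟) = w ((K.restrictOfFinrankEqTwo (by decide) Kcm finrank_Kcm).layerSubgroup n)
  /-- … and `frame.EU 𝔟` IS that class read in `𝐇′(S′_W) ≤ 𝐇′(𝒱′)`. -/
  EU_eq : ∀ 𝔟 : Ideal (𝓞 Kcm), IsTwist 7 𝔣 𝔟 → frame.EU 𝔟 = ιS (euK 𝔟)

attribute [instance] PinnedKatoGenusFrame.instContK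

/-! ## §2 Elementary API of the pinned frame -/

section Frame

variable {W : WeierstrassCurve ℚ} [W.IsElliptic] [W.IsGloballyMinimal] [Fact (Nat.Prime 7)]
  [ContinuousSMul ℤ_[7] (W.tateModule 7)] {K : ZpExtension ℚ 7} {hK : K.IsCyclotomic}
  {γ : Field.absoluteGaloisGroup ℚ} {I : IwasawaH1Data W 7 K γ}
  {F : GenusFrame} {θu : ∀ n : ℕ, globalUnitsOf (F.layer n)} {d : GenusDatum F θu}

namespace PinnedKatoGenusFrame

variable (Φ : PinnedKatoGenusFrame W K hK I d)

/-- `ιS y ∈ 𝐇′(S′_W)`. [cite: Kato2004Asterisque, 15.14 (p. 264)] -/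
theorem ιS_mem (y : Φ.IK.H) : Φ.ιS y ∈ Φ.frame.HS :=
  (Φ.mem_HS_iff _).mpr ⟨y, rfl⟩

/-- **`ιS` as an additive equivalence `IK.H ≃ 𝐇′(S′_W)`** (injective with range `HS`).
[cite: Kato2004Asterisque, 15.14 (p. 264)] [cite: NeukirchSchmidtWingberg2008, I §6 (Shapiro)] -/
def ιSEquiv : Φ.IK.H ≃+ Φ.frame.HS :=
  AddEquiv.ofBijective
    ({ toFun := fun y => ⟨Φ.ιS y, Φ.ιS_mem y⟩
       map_zero' := Subtype.ext (map_zero _)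
       map_add' := fun y y' => Subtype.ext (map_add _ y y') } : Φ.IK.H →+ Φ.frame.HS)
    ⟨fun y y' h => Φ.ιS_injective (congrArg Subtype.val h),
      fun x => by
        obtain ⟨y, hy⟩ := (Φ.mem_HS_iff x.1).mp x.2
        exact ⟨y, Subtype.ext hy⟩⟩

/-- Unfolding `ιSEquiv`. [cite: Kato2004Asterisque, 15.14 (p. 264)] -/
@[simp] theorem coe_ιSEquiv (y : Φ.IK.H) : ((Φ.ιSEquiv y : Φ.frame.HS) : Φ.A) = Φ.ιS y := rfl

/-- `ιS (ιSEquiv⁻¹ x) = x` for `x ∈ 𝐇′(S′_W)`. [cite: Kato2004Asterisque, 15.14 (p. 264)] -/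
theorem ιS_ιSEquiv_symm (x : Φ.frame.HS) : Φ.ιS (Φ.ιSEquiv.symm x) = (x : Φ.A) := by
  conv_rhs => rw [← Φ.ιSEquiv.apply_symm_apply x]
  rfl

/-- **The CM operator `piK : IK.H → IK.H` transported from `π` on `𝐇′(S′_W)`**: `piK y := ιS⁻¹ (π • ιS y)` (well defined
since `HS` is an `R`-submodule). [cite: Kato2004Asterisque, 15.14 (p. 264, "⊗_{O_λ[[G′_∞]]}")] -/
def piK : Φ.IK.H →+ Φ.IK.H where
  toFun y := Φ.ιSEquiv.symm ⟨Φ.π • Φ.ιS y, Φ.frame.HS.smul_mem _ (Φ.ιS_mem y)⟩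
  map_zero' := by
    have h : (⟨Φ.π • Φ.ιS 0, Φ.frame.HS.smul_mem _ (Φ.ιS_mem 0)⟩ : Φ.frame.HS) = 0 :=
      Subtype.ext (by simp)
    rw [h, map_zero]
  map_add' y y' := by
    rw [← map_add]
    congr 1
    exact Subtype.ext (by simp [smul_add])

/-- **`ιS (piK y) = π • ιS y`.** [cite: Kato2004Asterisque, 15.14 (p. 264)] -/
theorem ιS_piK (y : Φ.IK.H) : Φ.ιS (Φ.piK y) = Φ.π • Φ.ιS y :=
  Φ.ιS_ιSEquiv_symm _

/-- **The layers of `piK y` are `(T₇φ)_*` of the layers of `y`** — `π` acts on `𝐇′(S′_W) = H¹_Iw(Kℚ_∞/K, T₇W)` as the CM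
endomorphism `√−7` (pin `proj_pi`). [cite: Kato2004Asterisque, 15.14 (p. 264)] [cite: SerreGaloisCohomology1997, I §2.2] -/
theorem proj_piK (n : ℕ) (y : Φ.IK.H) :
    Φ.IK.proj n (Φ.piK y) =
      endLayerMap (W.baseChange Φ.Kcm) Φ.φ ((K.restrictOfFinrankEqTwo (by decide) Φ.Kcm Φ.finrank_Kcm).layerSubgroup n) (Φ.IK.proj n y) :=
  Φ.proj_pi n y _ (Φ.ιS_piK y)

/-- `piK` is determined by its layers: any `y′` with `ιS y′ = π • ιS y` IS `piK y`. [cite: Kato2004Asterisque, §12.2 (p. 220)] -/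
theorem eq_piK_of_ιS_eq {y y' : Φ.IK.H} (h : Φ.ιS y' = Φ.π • Φ.ιS y) : y' = Φ.piK y :=
  Φ.ιS_injective (by rw [h, Φ.ιS_piK])

/-- **`j = ιS ∘ res` pointwise**: the coefficient extension of a class of `𝐇¹_Γ(T₇W)` is its Shapiro restriction to `K`.
[cite: Kato2004Asterisque, 15.14 (p. 264)] [cite: NeukirchSchmidtWingberg2008, I §5–§6] -/
theorem j_apply (hγ : K.IsTopGenerator γ) (z : I.H) : Φ.j z = Φ.ιS (I.resOver Φ.IK hγ Φ.isTopGenerator_γK z) := by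
  rw [Φ.j_eq hγ]
  rfl

/-- The layers of `ιS⁻¹ (j z)`: `IK.proj n = res_n (I.proj n z)` (tree `proj_resOver`). [cite: NeukirchSchmidtWingberg2008, I §5 Prop. 1.5.4] -/
theorem proj_resOver_eq (hγ : K.IsTopGenerator γ) (n : ℕ) (z : I.H) :
    Φ.IK.proj n (I.resOver Φ.IK hγ Φ.isTopGenerator_γK z) =
      layerResOver K _ W n (I.proj n z) :=
  I.proj_resOver Φ.IK hγ Φ.isTopGenerator_γK n z

/-- **`frame.EU 𝔟 ∈ ιS(IK.H)` with Prop-15.9 layer classes**, unpacked. [cite: Kato2004Asterisque, Prop. 15.9 (15.9.1) (pp. 258–259) and (15.12.1) (p. 262)] -/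
theorem exists_body_of_isTwist {𝔟 : Ideal (𝓞 Φ.Kcm)} (h𝔟 : IsTwist 7 Φ.𝔣 𝔟) :
    ∃ (w : ∀ U : Subgroup (absoluteGaloisGroup Φ.Kcm), H1 (CM.tateRepK (W.baseChange Φ.Kcm) 7) U)
      (y : Subgroup (absoluteGaloisGroup Φ.Kcm) → AlgebraicClosure Φ.Kcm),
      CM.EllipticZetaBody Φ.Kcm (W.baseChange Φ.Kcm) 7 Φ.ψ (7 * F.d) Φ.ιC Φ.Ω Φ.𝔏 𝔟 w y ∧
      (∀ n : ℕ, Φ.IK.proj n (Φ.euK 𝔟) = w ((K.restrictOfFinrankEqTwo (by decide) Φ.Kcm Φ.finrank_Kcm).layerSubgroup n)) ∧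
      Φ.frame.EU 𝔟 = Φ.ιS (Φ.euK 𝔟) := by
  obtain ⟨w, y, hbody, hproj⟩ := Φ.euK_spec 𝔟 h𝔟
  exact ⟨w, y, hbody, hproj, Φ.EU_eq 𝔟 h𝔟⟩

/-- `φ ∘ φ = [−7]` on `T₇(W_K)`: `T₇φ ∘ T₇φ = −7`. [cite: SilvermanAEC2009, III.7.4] -/
theorem tateModule_map_φ_comp (x : (W.baseChange Φ.Kcm).tateModule 7) :
    TateModule.map 7 Φ.φ.toAddMonoidHom (TateModule.map 7 Φ.φ.toAddMonoidHom x) = (-7 : ℤ) • x := by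
  refine TateModule.ext fun n => ?_
  rw [TateModule.proj_map, TateModule.proj_map, map_zsmul]
  exact Φ.φ_sq _

end PinnedKatoGenusFrame

end Frame

/-! ## §3 The projections: pinned shape ⇒ (B1b) shape; the pinned closed-form LETTER ⇒ (B3)'s `hK2c` letter ⇒ RNV7 -/

section Projections

variable {W : WeierstrassCurve ℚ} [W.IsElliptic] [W.IsGloballyMinimal] [Fact (Nat.Prime 7)]
  [ContinuousSMul ℤ_[7] (W.tateModule 7)] {K : ZpExtension ℚ 7} {hK : K.IsCyclotomic}
  {γ : Field.absoluteGaloisGroup ℚ} {I : IwasawaH1Data W 7 K γ}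
  {F : GenusFrame} {θu : ∀ n : ℕ, globalUnitsOf (F.layer n)} {d : GenusDatum F θu}

/-- **Monotonicity (one line): a PINNED frame with the K2ᶜ shape yields a (B1b) frame with the shape** (projection
`toKatoGenusFrame`). [cite: Kato2004Asterisque, §15.16 (15.16.1) (p. 265)] -/
theorem residueIsGenusUnitClass_of_pinned
    (h : ∃ Φ : PinnedKatoGenusFrame W K hK I d, ResidueIsGenusUnitClassShape Φ.toKatoGenusFrame) :
    ∃ Φ : KatoGenusFrame W K hK I d, ResidueIsGenusUnitClassShape Φ :=
  h.elim fun Φ hΦ => ⟨Φ.toKatoGenusFrame, hΦ⟩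

end Projections

/-- **THE PINNED CLOSED FORM OF CRUX K2ᶜ («K2cPinned»; the letter the pen registers in zp v12) ⇒ (B3)'s `hK2c` LETTER
VERBATIM.**  «K2cPinned» := `★ → GZK → ∀ W ∈ 𝒞₇ ∀ (K, hK, γ, hγ, I), ∃ (F, θu) value-pinned, ∀ d, ∃ Φ : PinnedKatoGenusFrame
W K hK I d, ResidueIsGenusUnitClassShape Φ.toKatoGenusFrame` (antecedents ★ = `Kato2004.exists_zetaClassPosition_of_rank_le_one`
and GZK as ruled D887 T4: the ★-pin is inhabitable only through ★ under `rank_Λ I.H ≤ 1` ⟸ GZK).  Given ★ and GZK, it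
yields the registered stub's consequent (= (B3)'s `hK2c` binder, letter for letter) by `residueIsGenusUnitClass_of_pinned`.
CONDITIONAL; nothing asserted; 19945 stays OPEN.
[cite: Kato2004Asterisque, (15.16.1) (p. 265), Prop. 15.9 (p. 258), Thm. 12.5 (1) (p. 221)] -/
theorem hK2c_of_k2cPinned (hstar : exists_zetaClassPosition_of_rank_le_one)
    (hGZK : rank_eq_analyticRank_of_analyticRank_le_one)
    (hK2cP : exists_zetaClassPosition_of_rank_le_one → rank_eq_analyticRank_of_analyticRank_le_one →
      ∀ (W : WeierstrassCurve ℚ) [W.IsElliptic] [W.IsGloballyMinimal] [Fact (Nat.Prime 7)], X12.ClassCSeven W →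
      letI : ContinuousSMul ℤ_[7] (W.tateModule 7) := TateModule.continuousSMul_padicInt
      ∀ (K : ZpExtension ℚ 7) (hK : K.IsCyclotomic) (γ : Field.absoluteGaloisGroup ℚ) (_ : K.IsTopGenerator γ)
        (I : IwasawaH1Data W 7 K γ),
        ∃ (F : GenusFrame) (θu : ∀ n : ℕ, globalUnitsOf (F.layer n)), IsNormedEllipticUnitFamily F θu ∧
          ∀ d : GenusDatum F θu, ∃ Φ : PinnedKatoGenusFrame W K hK I d,
            ResidueIsGenusUnitClassShape Φ.toKatoGenusFrame) :
    ∀ (W : WeierstrassCurve ℚ) [W.IsElliptic] [W.IsGloballyMinimal] [Fact (Nat.Prime 7)], X12.ClassCSeven W →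
      letI : ContinuousSMul ℤ_[7] (W.tateModule 7) := TateModule.continuousSMul_padicInt
      ∀ (K : ZpExtension ℚ 7) (hK : K.IsCyclotomic) (γ : Field.absoluteGaloisGroup ℚ) (_ : K.IsTopGenerator γ)
        (I : IwasawaH1Data W 7 K γ),
        ∃ (F : GenusFrame) (θu : ∀ n : ℕ, globalUnitsOf (F.layer n)), IsNormedEllipticUnitFamily F θu ∧
          ∀ d : GenusDatum F θu, ∃ Φ : KatoGenusFrame W K hK I d, ResidueIsGenusUnitClassShape Φ := by
  intro W _ _ _ hC K hK γ hγ I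
  haveI : ContinuousSMul ℤ_[7] (W.tateModule 7) := TateModule.continuousSMul_padicInt
  obtain ⟨F, θu, hpin, hΦ⟩ := hK2cP hstar hGZK W hC K hK γ hγ I
  exact ⟨F, θu, hpin, fun d => residueIsGenusUnitClass_of_pinned (hΦ d)⟩

/-- **RNV7 (the body of `ResidualNonvanishingSeven`, = p765067's `hK2` binder) FROM THE PINNED CLOSED FORM**, the genus
residue input `hRes` of (B3), ★ and GZK — (B3)'s `residualNonvanishingSeven_of_genus` after `hK2c_of_k2cPinned`.
CONDITIONAL; nothing asserted; 19945 OPEN. [cite: Kato2004Asterisque, (15.16.1) (p. 265), Thm. 12.5 (1) (p. 221), Conj. 12.10 (p. 224)] -/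
theorem residualNonvanishingSeven_of_k2cPinned (hstar : exists_zetaClassPosition_of_rank_le_one)
    (hGZK : rank_eq_analyticRank_of_analyticRank_le_one)
    (hRes : ∀ (F : GenusFrame) (θu : ∀ n : ℕ, globalUnitsOf (F.layer n)), IsNormedEllipticUnitFamily F θu →
      ∃ d : GenusDatum F θu, GenusResidueNonzeroShape d)
    (hK2cP : exists_zetaClassPosition_of_rank_le_one → rank_eq_analyticRank_of_analyticRank_le_one →
      ∀ (W : WeierstrassCurve ℚ) [W.IsElliptic] [W.IsGloballyMinimal] [Fact (Nat.Prime 7)], X12.ClassCSeven W →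
      letI : ContinuousSMul ℤ_[7] (W.tateModule 7) := TateModule.continuousSMul_padicInt
      ∀ (K : ZpExtension ℚ 7) (hK : K.IsCyclotomic) (γ : Field.absoluteGaloisGroup ℚ) (_ : K.IsTopGenerator γ)
        (I : IwasawaH1Data W 7 K γ),
        ∃ (F : GenusFrame) (θu : ∀ n : ℕ, globalUnitsOf (F.layer n)), IsNormedEllipticUnitFamily F θu ∧
          ∀ d : GenusDatum F θu, ∃ Φ : PinnedKatoGenusFrame W K hK I d,
            ResidueIsGenusUnitClassShape Φ.toKatoGenusFrame) :
    ∀ (W : WeierstrassCurve ℚ) [W.IsElliptic] [W.IsGloballyMinimal] [Fact (Nat.Prime 7)], X12.ClassCSeven W →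
      letI : ContinuousSMul ℤ_[7] (W.tateModule 7) := TateModule.continuousSMul_padicInt
      ∀ (K : ZpExtension ℚ 7) (hK : K.IsCyclotomic) (γ : Field.absoluteGaloisGroup ℚ) (_ : K.IsTopGenerator γ)
        (I : IwasawaH1Data W 7 K γ) (z₀ : I.H), Kato2004.IsAdmissibleZetaClass W 7 K hK I z₀ →
        z₀ ∉ (IwasawaAlgebra.augIdealP 7 • (⊤ : Submodule (IwasawaAlgebra 7) I.H)) :=
  residualNonvanishingSeven_of_genus hRes (hK2c_of_k2cPinned hstar hGZK hK2cP)

end Summit.BirchSwinnertonDyer.Rank1Residual.Additive.GenusSeven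

end
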